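import Mathlib
import Summits.KontsevichZagierPeriods.Zeta5Search.Families.BasicGrowthSymmetry
import Summits.KontsevichZagierPeriods.Zeta5Search.Families.ExponentMonotone
import HarnessLib

/-!
# ζ(5) search — Families: Brown's function in PROJECTIVE form — `PGL₂`-invariance, duality `σ ↔ σ⁻¹`, bridge

HONEST FRAMING: systematic search; no irrationality claim unless certified.  STRUCTURAL facts about the size of
Brown's basic cellular integrals [Brown2016, §1.5 (1.3)–(1.4)] (seat P2, Families layer); nothing about the
arithmetic of any zeta value.

The growth constant `M_σ = fSup σ` (`Families/BasicGrowth.lean`: `I_σ(N)^{1/N} → M_σ`) is the supremum over the open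
simplex of the SIMPLICIAL function `fSigma σ t` — Brown's `f_σ = ∏_i (z_i − z_{i+1}) / ∏_i (z_{σ_i} − z_{σ_{i+1}})`
[Brown2016, §1.5 (1.3)] evaluated at the normal form `(z_1,…,z_n) = (0, t_1, …, t_ℓ, 1, ∞)` with the factors through `∞`
omitted.  This file sets up the PROJECTIVE form needed to compare a configuration with its DUAL `σ⁻¹` (the exact atlas
`Families/Exact*` observes that dual classes have RECIPROCAL minimal polynomials; `Families/ExactDualityBZ` proves
`M_{₈π₈} · λ₃ = 1` for the Brown–Zudilin pair):
* `FSigma σ z = |∏_i (z_i − z_{i+1})| / |∏_i (z_{σ_i} − z_{σ_{i+1}})|` for a configuration `z` of `n = ℓ+3` FINITE real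
  points;
* **`FSigma_dual`** — for `σ ∘ τ = id`: `F_τ(z ∘ σ) = 1 / F_σ(z)` (relabelling by `σ` swaps numerator and
  denominator: the function-level reason for the reciprocity);
* `prod_edgeLaw` — the edge-law engine: if `E'(u,v)·W(u)W(v) = E(u,v)·κ` for `u ≠ v` then the cyclic edge products
  over any injective seating differ by `(∏ W)²` versus `κ^n` (every vertex of a polygon lies on two of its edges —
  Brown's homogeneity (5.2) for constant exponents [Brown2016, §5.1]);
* **`FSigma_moebius`** — `F_σ(g ∘ z) = F_σ(z)` for every Möbius map `g = (a x + b)/(c x + d)`, `ad − bc ≠ 0`, finite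
  on the configuration (`σ` bijective): `F_σ` is a function on `M_{0,n}(ℝ)`;
* **`fSigma_eq_FSigma_zOf`** — the bridge: `f_σ(t) = F_σ(zOf t)` on the open simplex, where
  `zOf t = (x ↦ x/(1+x)) ∘ (0, t, 1, ∞) = (0, t_1/(1+t_1), …, 1/2, 1)` is a finite representative of the normal form.
The sequel `Families/BasicGrowthDuality.lean` draws the consequence `1/M_{σ⁻¹} = inf_{X_σ} F_σ`.  Standard axioms only.
-/

noncomputable section

open Finset Set

namespace Summit.KontsevichZagierPeriods.Zeta5Search.Families.Cellular

variable {ℓ : ℕ} (σ : Fin (ℓ + 3) → Fin (ℓ + 3))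

/-! ### Brown's function of a configuration of `n` finite real points -/

/-- **Brown's function in projective form.**  For a configuration `z` of `n = ℓ + 3` FINITE real points,
`F_σ(z) = |∏_i (z_i − z_{i+1})| / |∏_i (z_{σ_i} − z_{σ_{i+1}})|` (indices mod `n`): the edges of the standard polygon
`δ⁰` over the edges of `σδ⁰`.  For bijective `σ` every label occurs twice above and twice below, so `F_σ` is
invariant under `PGL₂(ℝ)` (`FSigma_moebius`); its restriction to the normal forms `(0, t, 1, ∞)` is the simplicial
`fSigma σ` (`fSigma_eq_FSigma_zOf`). [Brown2016, §1.5 (1.3); structural] -/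
def FSigma (σ : Fin (ℓ + 3) → Fin (ℓ + 3)) (z : Fin (ℓ + 3) → ℝ) : ℝ :=
  |∏ i : Fin (ℓ + 3), (z i - z (i + 1))| / |∏ i : Fin (ℓ + 3), (z (σ i) - z (σ (i + 1)))|

/-- `0 ≤ F_σ(z)`. -/
theorem FSigma_nonneg (z : Fin (ℓ + 3) → ℝ) : 0 ≤ FSigma σ z :=
  div_nonneg (abs_nonneg _) (abs_nonneg _)

/-- **Duality `σ ↔ σ⁻¹` at the level of functions.**  If `σ ∘ τ = id` then
`F_τ(z ∘ σ) = 1 / F_σ(z)`: relabelling the points by `σ` turns the numerator of `F_τ` into the denominator of `F_σ`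
and (because `σ (τ i) = i`) the denominator of `F_τ` into the numerator of `F_σ`. -/
theorem FSigma_dual {σ τ : Fin (ℓ + 3) → Fin (ℓ + 3)} (hστ : ∀ i, σ (τ i) = i) (z : Fin (ℓ + 3) → ℝ) :
    FSigma τ (z ∘ σ) = (FSigma σ z)⁻¹ := by
  unfold FSigma
  rw [inv_div]
  simp only [Function.comp_apply, hστ]

/-- `F_τ(z ∘ σ) · F_σ(z) = 1` whenever `F_σ(z) ≠ 0` (e.g. all points distinct). -/
theorem FSigma_dual_mul {σ τ : Fin (ℓ + 3) → Fin (ℓ + 3)} (hστ : ∀ i, σ (τ i) = i) {z : Fin (ℓ + 3) → ℝ}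
    (hz : FSigma σ z ≠ 0) : FSigma τ (z ∘ σ) * FSigma σ z = 1 := by
  rw [FSigma_dual hστ, inv_mul_cancel₀ hz]

/-! ### The edge-law engine: vertex weights cancel for bijective seatings -/

/-- **Edge-law engine.**  If two edge functions are related by `E' u v · (W u · W v) = E u v · κ` for all `u ≠ v`
(a "vertex-weight law", as for Möbius maps), then for every INJECTIVE seating `σ` the cyclic edge products satisfy
`∏_i E'(σ_i, σ_{i+1}) · (∏_k W(σ_k))² = ∏_i E(σ_i, σ_{i+1}) · κ^n` — every vertex of the polygon `σδ⁰` lies on exactly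
two of its edges. -/
theorem prod_edgeLaw {σ : Fin (ℓ + 3) → Fin (ℓ + 3)} (hσ : Function.Injective σ) (E E' : Fin (ℓ + 3) → Fin (ℓ + 3) → ℝ)
    (W : Fin (ℓ + 3) → ℝ) (κ : ℝ) (h : ∀ u v, u ≠ v → E' u v * (W u * W v) = E u v * κ) :
    (∏ i : Fin (ℓ + 3), E' (σ i) (σ (i + 1))) * ((∏ i : Fin (ℓ + 3), W (σ i)) * ∏ i : Fin (ℓ + 3), W (σ i)) =
      (∏ i : Fin (ℓ + 3), E (σ i) (σ (i + 1))) * κ ^ (ℓ + 3) := by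
  have e : ∏ i : Fin (ℓ + 3), W (σ (i + 1)) = ∏ i : Fin (ℓ + 3), W (σ i) :=
    Fintype.prod_equiv (Equiv.addRight 1) _ (fun j => W (σ j)) fun i => rfl
  have hprod : (∏ i : Fin (ℓ + 3), E' (σ i) (σ (i + 1)) * (W (σ i) * W (σ (i + 1)))) =
      ∏ i : Fin (ℓ + 3), E (σ i) (σ (i + 1)) * κ :=
    Finset.prod_congr rfl fun i _ => h _ _ fun he => succ_ne_self i (hσ he)
  rw [prod_mul_distrib, prod_mul_distrib, prod_mul_distrib, prod_const, card_univ, Fintype.card_fin, e] at hprod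
  exact hprod

/-! ### `PGL₂`-invariance -/

/-- The factor law of a Möbius map `g(x) = (a x + b)/(c x + d)`:
`(g(x) − g(y)) · ((c x + d)(c y + d)) = (a d − b c) · (x − y)`. -/
theorem moebius_sub_mul {a b c d x y : ℝ} (hx : c * x + d ≠ 0) (hy : c * y + d ≠ 0) :
    ((a * x + b) / (c * x + d) - (a * y + b) / (c * y + d)) * ((c * x + d) * (c * y + d)) =
      (x - y) * (a * d - b * c) := by
  rw [div_sub_div _ _ hx hy, div_mul_cancel₀ _ (mul_ne_zero hx hy)]
  ring

/-- **`PGL₂(ℝ)`-invariance of Brown's function**: for a bijective seating `σ`, a Möbius map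
`g(x) = (a x + b)/(c x + d)` (`a d − b c ≠ 0`) finite at every point of the configuration does not change `F_σ`:
`F_σ(g ∘ z) = F_σ(z)`.  (Each label carries the weight `c z_k + d` twice in the numerator and twice in the
denominator — Brown's homogeneity for constant exponents [Brown2016, §5.1 (5.2)].) -/
theorem FSigma_moebius (hσ : Function.Bijective σ) (z : Fin (ℓ + 3) → ℝ) {a b c d : ℝ}
    (hdet : a * d - b * c ≠ 0) (hz : ∀ k, c * z k + d ≠ 0) :
    FSigma σ (fun k => (a * z k + b) / (c * z k + d)) = FSigma σ z := by
  set g : Fin (ℓ + 3) → ℝ := fun k => (a * z k + b) / (c * z k + d) with hg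
  set P : ℝ := ∏ k : Fin (ℓ + 3), (c * z k + d) with hP
  have hP0 : P ≠ 0 := Finset.prod_ne_zero_iff.2 fun k _ => hz k
  have hPP : P * P ≠ 0 := mul_ne_zero hP0 hP0
  have hκ : (a * d - b * c) ^ (ℓ + 3) ≠ 0 := pow_ne_zero _ hdet
  have law : ∀ u v : Fin (ℓ + 3), u ≠ v →
      (g u - g v) * ((c * z u + d) * (c * z v + d)) = (z u - z v) * (a * d - b * c) :=
    fun u v _ => moebius_sub_mul (hz u) (hz v)
  -- numerator (σ = id) and denominator
  have hnum := prod_edgeLaw (σ := id) Function.injective_id (fun u v => z u - z v) (fun u v => g u - g v)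
    (fun k => c * z k + d) _ law
  have hden := prod_edgeLaw hσ.1 (fun u v => z u - z v) (fun u v => g u - g v) (fun k => c * z k + d) _ law
  have eσ : ∏ i : Fin (ℓ + 3), (c * z (σ i) + d) = P :=
    Fintype.prod_equiv (Equiv.ofBijective σ hσ) _ _ fun i => rfl
  simp only [id] at hnum
  rw [eσ] at hden
  rw [← hP] at hnum
  have hA : (∏ i : Fin (ℓ + 3), (g i - g (i + 1))) =
      (∏ i : Fin (ℓ + 3), (z i - z (i + 1))) * ((a * d - b * c) ^ (ℓ + 3) / (P * P)) := by
    rw [← mul_div_assoc, eq_div_iff hPP]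
    exact hnum
  have hB : (∏ i : Fin (ℓ + 3), (g (σ i) - g (σ (i + 1)))) =
      (∏ i : Fin (ℓ + 3), (z (σ i) - z (σ (i + 1)))) * ((a * d - b * c) ^ (ℓ + 3) / (P * P)) := by
    rw [← mul_div_assoc, eq_div_iff hPP]
    exact hden
  unfold FSigma
  rw [hA, hB, abs_mul, abs_mul, mul_div_mul_right _ _ (abs_ne_zero.2 (div_ne_zero hκ hPP))]


/-! ### The bridge to simplicial coordinates -/

/-- The FINITE representative of the normal form `(0, t₁, …, t_ℓ, 1, ∞)`: its image under the Möbius map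
`x ↦ x/(1+x)`, i.e. `zOf t k = pt t k / (1 + pt t k)` at the finite labels `k ≤ ℓ + 1` and `zOf t ∞ = 1`. -/
def zOf (t : Fin ℓ → ℝ) (k : Fin (ℓ + 3)) : ℝ :=
  if k.val = ℓ + 2 then 1 else pt t k.val / (1 + pt t k.val)

/-- The vertex weights of the bridge: `1 + pt t k` at a finite label `k`, and `1` at `∞`. -/
def wOf (t : Fin ℓ → ℝ) (k : Fin (ℓ + 3)) : ℝ := if k.val = ℓ + 2 then 1 else 1 + pt t k.val

/-- The bridge weights are positive on the open simplex. -/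
theorem wOf_pos {t : Fin ℓ → ℝ} (ht : t ∈ openSimplex ℓ) (k : Fin (ℓ + 3)) : 0 < wOf t k := by
  unfold wOf
  split_ifs
  · exact one_pos
  · linarith [pt_nonneg ht k.val]

/-- **The edge law of the bridge** (ordered labels): for `u < v`,
`zOf t v − zOf t u = ef t u v / (wOf t u · wOf t v)`. -/
theorem zOf_sub_zOf_of_lt {t : Fin ℓ → ℝ} (ht : t ∈ openSimplex ℓ) {u v : Fin (ℓ + 3)} (huv : u.val < v.val) :
    zOf t v - zOf t u = ef t u v / (wOf t u * wOf t v) := by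
  have hvlt := v.isLt
  have hpu : 0 ≤ pt t u.val := pt_nonneg ht u.val
  have hu : u.val ≠ ℓ + 2 := by omega
  by_cases hv : v.val = ℓ + 2
  · rw [ef_infty_right t u v hv]
    unfold zOf wOf
    rw [if_pos hv, if_neg hu, if_pos hv, if_neg hu]
    field_simp
    ring
  · have hpv : 0 ≤ pt t v.val := pt_nonneg ht v.val
    rw [ef_of_lt t huv hv]
    unfold zOf wOf
    rw [if_neg hv, if_neg hu, if_neg hv, if_neg hu]
    field_simp
    ring

/-- The edge law of the bridge, weight form: for `u ≠ v`,
`|zOf t u − zOf t v| · (wOf t u · wOf t v) = ef t u v · 1`. -/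
theorem abs_zOf_sub_mul {t : Fin ℓ → ℝ} (ht : t ∈ openSimplex ℓ) {u v : Fin (ℓ + 3)} (huv : u ≠ v) :
    |zOf t u - zOf t v| * (wOf t u * wOf t v) = ef t u v * 1 := by
  have hW : 0 < wOf t u * wOf t v := mul_pos (wOf_pos ht u) (wOf_pos ht v)
  rcases Nat.lt_or_gt_of_ne (fun h => huv (Fin.ext h)) with h | h
  · have hpos : 0 < zOf t v - zOf t u := by
      rw [zOf_sub_zOf_of_lt ht h]; exact div_pos (ef_pos ht huv) hW
    rw [abs_sub_comm, abs_of_pos hpos, zOf_sub_zOf_of_lt ht h, div_mul_cancel₀ _ hW.ne', mul_one]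
  · have hpos : 0 < zOf t u - zOf t v := by
      rw [zOf_sub_zOf_of_lt ht h]; exact div_pos (ef_pos ht huv.symm) (by rwa [mul_comm])
    rw [abs_of_pos hpos, zOf_sub_zOf_of_lt ht h, mul_comm (wOf t u),
      div_mul_cancel₀ _ (mul_pos (wOf_pos ht v) (wOf_pos ht u)).ne', ef_comm, mul_one]

/-- **The bridge**: for a bijective seating `σ` and `t` in the open simplex, the simplicial `f_σ(t)` is the value of
the projective `F_σ` at the finite representative `zOf t` of the normal form `(0, t, 1, ∞)` (the vertex weights
`1 + pt t k` cancel, each label lying on two edges of `δ⁰` and two of `σδ⁰`). -/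
theorem fSigma_eq_FSigma_zOf (hσ : Function.Bijective σ) {t : Fin ℓ → ℝ} (ht : t ∈ openSimplex ℓ) :
    fSigma σ t = FSigma σ (zOf t) := by
  set P : ℝ := ∏ k : Fin (ℓ + 3), wOf t k with hP
  have hP0 : P ≠ 0 := Finset.prod_ne_zero_iff.2 fun k _ => (wOf_pos ht k).ne'
  have hPP : P * P ≠ 0 := mul_ne_zero hP0 hP0
  have law : ∀ u v : Fin (ℓ + 3), u ≠ v →
      |zOf t u - zOf t v| * (wOf t u * wOf t v) = ef t u v * 1 := fun u v huv => abs_zOf_sub_mul ht huv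
  have hnum := prod_edgeLaw (σ := id) Function.injective_id (ef t) (fun u v => |zOf t u - zOf t v|) (wOf t) 1 law
  have hden := prod_edgeLaw hσ.1 (ef t) (fun u v => |zOf t u - zOf t v|) (wOf t) 1 law
  have eσ : ∏ i : Fin (ℓ + 3), wOf t (σ i) = P := Fintype.prod_equiv (Equiv.ofBijective σ hσ) _ _ fun i => rfl
  simp only [id] at hnum
  rw [← hP, one_pow, mul_one] at hnum
  rw [eσ, one_pow, mul_one] at hden
  unfold FSigma fSigma formDen
  rw [abs_prod, abs_prod, ← hnum, ← hden, mul_div_mul_right _ _ hPP]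

end Summit.KontsevichZagierPeriods.Zeta5Search.Families.Cellular
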